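import Summits.QuantumFields.YangMills.Theorems.TransportPerturbationSolutionFamilyOfMeasurableFlow
import Summits.QuantumFields.YangMills.Theorems.ColdStartUniversalityLatticeLangevinMeasurableFlow
import HarnessLib

/-!
# Route `TransportPerturbation`: support item `SolutionFamily` (stmt-QuantumFields-26920) — PROVED

`SolutionFamily`: for every `F`, `γ > 0`, `K` there are a probability space, a flat Brownian driver and a family
`V : SU(2)^E → (ℝ≥0 → Ω → SU(2)^E)` of solutions of the Shen–Zhu–Zhu system at `β' = (γ ε_K)⁻¹/2` from EVERY start,
adapted to the raw natural filtration of the driver, with `(x, ω) ↦ V x t ω` jointly measurable for every `t`.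
It is the conditional closure `solutionFamily_of_measurableFlow` (planner, seat ym-idea-5 g6) composed with the now
discharged named fact `LatticeLangevinMeasurableFlow (fundamentalLatticeRep 2) 3 L β` (seat `ym-line-csu-p1` g4,
`ColdStartUniversality.latticeLangevinMeasurableFlow_su2`: measurable modification of the strong solutions along
measurable `4⁻ⁿ`-nets of starts, quantitative continuous dependence + Borel–Cantelli).  No definition, no sorry.
RECORD-rung R3 plumbing for route `TransportPerturbation`; nothing here bears on the Yang–Mills mass gap.
-/

set_option autoImplicit false

namespace Summit.QuantumFields.YangMills.Theorems.TransportPerturbation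

/-- ★ **`SolutionFamily` (stmt-QuantumFields-26920) holds unconditionally**: Kunita's jointly measurable version of the
SZZ strong-solution family for `SU(2)` on Bałaban's `K`-th lattice, on the product Wiener space.
[cite: Kunita1984, Ch. II §2 Thm 2.2 (LNM 1097, p. 188)] [cite: ShenZhuZhu2022, §3 Lemma 3.2 (p. 13)] -/
theorem solutionFamily_proof : Summit.QuantumFields.YangMills.Theses.TransportPerturbation.SolutionFamily :=
  solutionFamily_of_measurableFlow fun L _ β => ColdStartUniversality.latticeLangevinMeasurableFlow_su2 L β

end Summit.QuantumFields.YangMills.Theorems.TransportPerturbation
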